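import Summits.PneNP.PneNP.Theorems.SupportRectangleBlockLift
import Literature.Barriers.PneNP.TSPExtensionComplexityKaibelWeltge
import HarnessLib

/-!
# Block psd factorizations of the unique-disjointness matrix and of the correlation polytope (cell pnp-psdrank, eng g5)

Instantiation of the support-rectangle block theorem `SupportRectangleBlockLift.blockBound_supp` with the
tree's Kaibel–Weltge lemma (`Literature.Barriers.PneNP.IsKWValid.card_le_two_pow`: a rectangle avoiding the
pairs `|a ∩ c| = 1` contains at most `2^n` disjoint pairs [cite: KaibelWeltge2014, Thm. 1]):

* `udisj n a c = (1 − |a ∩ c|)²` — the unique-disjointness matrix `UDISJ(n)` on subsets of `Fin n`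
  (rows/columns = `{0,1}^n`), FMPTW's submatrix of the slack matrix of the correlation polytope
  [cite: FawziParrilo2013, Def. 3 (§2)];
* `udisj_blockPsd` — **every `(S^b_+)^m` factorization of `UDISJ(n)` (`n ≥ 2`, `b ≥ 1`) has
  `(3/2)^{n/(b+1)} ≤ m · 14400 b⁵ n⁶`**;
* `corr_blockPsd` — the same for every block-diagonal psd factorization (`m` blocks of size `b`) of the FULL
  slack matrix of the correlation polytope `CORR_n = conv{x xᵀ : x ∈ {0,1}ⁿ}` (all valid inequalities ×
  all vertices, the index types of the tree's `Literature.Combinatorics.Optimization.LeeRaghavendraSteurer2015_thm11`),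
  i.e. — by the cone factorization theorem [cite: FawziParrilo2013, Thm. 2 and eq. (5)] — for every
  `(S^b_+)^m`-lift of `CORR_n` (equivalently of the cut polytope `CUT(n+1)`): the rows
  `2Σ_{i∈a} X_{ii} − Σ_{i,j∈a} X_{ij} ≤ 1` have slack `(1 − |a ∩ c|)²` at the vertex `1_c 1_cᵀ`.

Comparison with print: Fawzi–Parrilo [cite: FawziParrilo2013, Thm. 1] prove `m ≥ κ(b)·c(b)^n` with
`c(b) = (1 − 3^{−b})^{−1/b}` (`≈ 1 + 3^{−b}/b`; `c(2)` refined to `√(9/7) ≈ 1.134`), which is void once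
`b ≳ log₃ n`; here `m ≥ 1.5^{n/(b+1)}/(14400 b⁵ n⁶)` (`1.5^{1/3} ≈ 1.1447` at `b = 2`, `1.5^{1/4} ≈ 1.107`
vs `1.0126` at `b = 3`), meaningful for all block sizes `b = o(n / log n)`: a block-diagonal SDP lift of the
cut polytope with polynomially many blocks has a block of dimension `Ω(n / log n)`. The general psd rank of
`CORR_n` is `2^{Ω(n^{2/13})}` [cite: LeeRaghavendraSteurer2015, Thm. 1.1] (named fact in the tree, not used).
WHAT THIS IS NOT: not a bound on general psd rank / SDP extension complexity (`UDISJ(n)` itself has psd rank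
`≤ n + 1`: `(1 − aᵀc)² = ⟨(1,a)(1,a)ᵀ, (1,−c)(1,−c)ᵀ⟩`, so one block of dimension `n + 1` suffices — the
bound is about MANY SMALL blocks); nothing here is P ≠ NP-relevant; constants not optimised.
-/

set_option linter.dupNamespace false -- `Summit.PneNP.PneNP.…`: summit = sub-problem (D-0017)

noncomputable section

open scoped Classical MatrixOrder

open Finset Real Matrix Literature.Barriers.PneNP

namespace Summit.PneNP.PneNP.Theorems.SupportRectangleBlockLift

variable {n : ℕ}

/-! ### The unique-disjointness matrix and its Kaibel–Weltge datum -/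

/-- The **unique-disjointness matrix** `UDISJ(n)(a, c) = (1 − |a ∩ c|)²` on subsets `a, c ⊆ Fin n`.
[cite: FawziParrilo2013, Def. 3 (§2)] [cite: KaibelWeltge2014, §3] -/
def udisj (n : ℕ) (a c : Finset (Fin n)) : ℝ := ((1 : ℝ) - ((a ∩ c).card : ℝ)) ^ 2

/-- `UDISJ(n)(a, c) = 0` exactly on the pairs with `|a ∩ c| = 1`. -/
theorem udisj_eq_zero_iff (a c : Finset (Fin n)) : udisj n a c = 0 ↔ (a ∩ c).card = 1 := by
  unfold udisj
  rw [sq_eq_zero_iff, sub_eq_zero]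
  constructor
  · intro h; exact_mod_cast h.symm
  · intro h; rw [h]; norm_num

/-- `UDISJ(n)(a, c) = 1` on disjoint pairs. -/
theorem udisj_of_disjoint {a c : Finset (Fin n)} (h : Disjoint a c) : udisj n a c = 1 := by
  unfold udisj
  rw [disjoint_iff_inter_eq_empty.1 h, card_empty]
  norm_num

/-- Entries of `UDISJ(n)` are at most `n²` (`n ≥ 1`). -/
theorem udisj_le_sq (hn : 1 ≤ n) (a c : Finset (Fin n)) : udisj n a c ≤ (n : ℝ) ^ 2 := by
  unfold udisj
  have hk : ((a ∩ c).card : ℝ) ≤ n := by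
    have h1 : (a ∩ c).card ≤ Fintype.card (Fin n) := card_le_univ _
    rw [Fintype.card_fin] at h1
    exact_mod_cast h1
  have hk0 : (0 : ℝ) ≤ ((a ∩ c).card : ℝ) := Nat.cast_nonneg _
  have hn1 : (1 : ℝ) ≤ n := by exact_mod_cast hn
  have habs : |(1 : ℝ) - ((a ∩ c).card : ℝ)| ≤ n := by
    rw [abs_le]; constructor <;> linarith
  calc ((1 : ℝ) - ((a ∩ c).card : ℝ)) ^ 2 = |(1 : ℝ) - ((a ∩ c).card : ℝ)| ^ 2 := (sq_abs _).symm
    _ ≤ (n : ℝ) ^ 2 := pow_le_pow_left₀ (abs_nonneg _) habs 2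

/-- The **Kaibel–Weltge weight**: uniform on the `3^n` disjoint pairs. -/
def kwWeight (n : ℕ) (a c : Finset (Fin n)) : ℝ := if Disjoint a c then ((3 : ℝ) ^ n)⁻¹ else 0

/-- `kwWeight ≥ 0`. -/
theorem kwWeight_nonneg (a c : Finset (Fin n)) : 0 ≤ kwWeight n a c := by
  unfold kwWeight; split_ifs <;> positivity

/-- The pairs of disjoint subsets of `Fin n` are the tree's `disjPairs univ`. -/
theorem filter_disjoint_eq_disjPairs :
    ((univ : Finset (Finset (Fin n))) ×ˢ (univ : Finset (Finset (Fin n)))).filter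
      (fun p => Disjoint p.1 p.2) = disjPairs (univ : Finset (Fin n)) := by
  unfold disjPairs
  rw [powerset_univ]

/-- A rectangle sum of `kwWeight` is the number of disjoint pairs in it over `3^n`. -/
theorem sum_kwWeight_eq (X Y : Finset (Finset (Fin n))) :
    ∑ a ∈ X, ∑ c ∈ Y, kwWeight n a c =
      (((X ×ˢ Y).filter (fun p => Disjoint p.1 p.2)).card : ℝ) * ((3 : ℝ) ^ n)⁻¹ := by
  rw [← sum_product' (f := fun a c => kwWeight n a c)]
  unfold kwWeight
  rw [← sum_filter, sum_const, nsmul_eq_mul]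

/-- `Σ kwWeight = 1` (there are `3^n` disjoint pairs, `card_disjPairs`). -/
theorem sum_kwWeight : ∑ a, ∑ c, kwWeight n a c = 1 := by
  have h := sum_kwWeight_eq (n := n) univ univ
  rw [h, filter_disjoint_eq_disjPairs, card_disjPairs, card_univ, Fintype.card_fin]
  push_cast
  exact mul_inv_cancel₀ (by positivity)

/-- `⟨kwWeight, UDISJ(n)⟩ = 1` (the weight lives on the disjoint pairs, where the entry is `1`). -/
theorem sum_kwWeight_mul_udisj : ∑ a, ∑ c, kwWeight n a c * udisj n a c = 1 := by
  have h : ∀ a c, kwWeight n a c * udisj n a c = kwWeight n a c := by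
    intro a c
    unfold kwWeight
    split_ifs with hd
    · rw [udisj_of_disjoint hd, mul_one]
    · rw [zero_mul]
  simp_rw [h]
  exact sum_kwWeight

/-- **The Kaibel–Weltge datum in support form**: a rectangle inside the support of `UDISJ(n)` (no pair
with `|a ∩ c| = 1`) has `kwWeight`-mass at most `(2/3)^n`. [cite: KaibelWeltge2014, Thm. 1 (proof)] -/
theorem kwWeight_rect (X Y : Finset (Finset (Fin n))) (h : ∀ a ∈ X, ∀ c ∈ Y, udisj n a c ≠ 0) :
    ∑ a ∈ X, ∑ c ∈ Y, kwWeight n a c ≤ (2 : ℝ) ^ n * ((3 : ℝ) ^ n)⁻¹ := by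
  rw [sum_kwWeight_eq]
  refine mul_le_mul_of_nonneg_right ?_ (by positivity)
  set R := (X ×ˢ Y).filter (fun p => Disjoint p.1 p.2) with hR
  have hval : IsKWValid R := by
    intro p hp q hq
    rw [hR, mem_filter, mem_product] at hp hq
    have h1 := h p.1 hp.1.1 q.2 hq.1.2
    rwa [Ne, udisj_eq_zero_iff] at h1
  have hsub : R ⊆ disjPairs (univ : Finset (Fin n)) := by
    intro p hp
    rw [hR, mem_filter] at hp
    exact mem_disjPairs.2 ⟨subset_univ _, subset_univ _, hp.2⟩
  have hcard := IsKWValid.card_le_two_pow univ R hval hsub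
  rw [card_univ, Fintype.card_fin] at hcard
  exact_mod_cast hcard

/-! ### The block bound for `UDISJ(n)` -/

/-- **Block psd factorizations of the unique-disjointness matrix.** For `n ≥ 2`, `b ≥ 1`: if
`UDISJ(n)(a, c) = (1 − |a ∩ c|)² = Σ_{i < m} tr(A_a^i B_c^i)` with psd `b × b` blocks `A_a^i, B_c^i`, then
`(3/2)^{n/(b+1)} ≤ m · 14400 b⁵ n⁶`. (The support-rectangle block theorem `blockBound_supp` with the
Kaibel–Weltge datum: `Δ = n²`, `θ₀ = (2/3)^n`, `(2/θ₀)^{1/(b+1)} ≥ (3/2)^{n/(b+1)}`.) Fawzi–Parrilo's bound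
for the same quantity is `κ(b)((1 − 3^{−b})^{−1/b})^n` [cite: FawziParrilo2013, Thm. 1 / eq. (12)]. -/
theorem udisj_blockPsd {b m : ℕ} (hn : 2 ≤ n) (hb : 1 ≤ b)
    (A : Finset (Fin n) → Fin m → Matrix (Fin b) (Fin b) ℝ)
    (B : Finset (Fin n) → Fin m → Matrix (Fin b) (Fin b) ℝ)
    (hA : ∀ a i, (A a i).PosSemidef) (hB : ∀ c i, (B c i).PosSemidef)
    (hfac : ∀ a c, udisj n a c = ∑ i, (A a i * B c i).trace) :
    (3 / 2 : ℝ) ^ ((n : ℝ) / (b + 1)) ≤ m * (14400 * (b : ℝ) ^ 5 * (n : ℝ) ^ 6) := by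
  have hn1 : 1 ≤ n := le_trans one_le_two hn
  have hn2 : (2 : ℝ) ≤ n := by exact_mod_cast hn
  have hΔ2 : (2 : ℝ) ≤ (n : ℝ) ^ 2 := by nlinarith
  have hθ0 : (0 : ℝ) < (2 : ℝ) ^ n * ((3 : ℝ) ^ n)⁻¹ := by positivity
  have key := blockBound_supp (udisj n) (kwWeight n) (kwWeight n) hΔ2 hθ0 (udisj_le_sq hn1)
    kwWeight_nonneg (fun a c => le_rfl) sum_kwWeight.le sum_kwWeight_mul_udisj kwWeight_rect hb A B hA hB
    hfac
  have hpow : ((n : ℝ) ^ 2) ^ 3 = (n : ℝ) ^ 6 := by ring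
  rw [hpow] at key
  refine le_trans ?_ key
  -- `(3/2)^{n/(b+1)} ≤ (2 · (3/2)^n)^{1/(b+1)}`
  have hb1 : (0 : ℝ) < (b : ℝ) + 1 := by positivity
  have h32 : (2 : ℝ) / ((2 : ℝ) ^ n * ((3 : ℝ) ^ n)⁻¹) = 2 * (3 / 2 : ℝ) ^ n := by
    rw [div_pow]; field_simp
  rw [h32]
  have h1 : (3 / 2 : ℝ) ^ ((n : ℝ) / (b + 1)) = ((3 / 2 : ℝ) ^ n) ^ ((1 : ℝ) / (b + 1)) := by
    rw [← Real.rpow_natCast, ← Real.rpow_mul (by norm_num)]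
    congr 1
    field_simp
  rw [h1]
  refine Real.rpow_le_rpow (by positivity) ?_ (by positivity)
  have h2 : (0 : ℝ) ≤ (3 / 2 : ℝ) ^ n := by positivity
  linarith

/-! ### The correlation polytope -/

/-- The row of the slack matrix of `CORR_n` used for `a ⊆ Fin n`: the valid inequality
`⟨c_a, X⟩ ≤ 1` with `c_a(i,j) = [i ∈ a][j ∈ a](2[i = j] − 1)`, i.e. `2Σ_{i∈a} X_{ii} − Σ_{i,j∈a} X_{ij} ≤ 1`,
whose slack at a `0/1` point `x xᵀ` is `(1 − Σ_{i∈a} x_i)²`. [cite: FawziParrilo2013, §2 (proof strategy)] -/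
def corRowMat (a : Finset (Fin n)) : Matrix (Fin n) (Fin n) ℝ :=
  fun i j => (if i ∈ a then (1 : ℝ) else 0) * (if j ∈ a then 1 else 0) * (if i = j then 1 else -1)

/-- The quadratic form of `corRowMat a` at a `0/1` point: `Σ_{ij} c_a(i,j) x_i x_j = 2s − s²` with
`s = Σ_{i∈a} x_i`. -/
theorem corRowMat_form (a : Finset (Fin n)) (x : Fin n → ℝ) (hx : ∀ i, x i = 0 ∨ x i = 1) :
    ∑ i, ∑ j, corRowMat a i j * (x i * x j) =
      2 * (∑ i, (if i ∈ a then (1 : ℝ) else 0) * x i) - (∑ i, (if i ∈ a then (1 : ℝ) else 0) * x i) ^ 2 := by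
  set y : Fin n → ℝ := fun i => (if i ∈ a then (1 : ℝ) else 0) * x i with hy
  have hyy : ∀ i, y i * y i = y i := by
    intro i
    simp only [hy]
    rcases hx i with h | h <;> simp [h]
  have hterm : ∀ i j, corRowMat a i j * (x i * x j) =
      (if i = j then 2 * (y i * y j) else 0) - y i * y j := by
    intro i j
    simp only [corRowMat, hy]
    split_ifs <;> ring
  simp_rw [hterm, sum_sub_distrib]
  congr 1
  · simp only [sum_ite_eq, mem_univ, if_true]
    rw [mul_sum]
    exact sum_congr rfl fun i _ => by rw [hyy i]
  · rw [sq, sum_mul_sum]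

/-- The inequality `⟨c_a, x xᵀ⟩ ≤ 1` is valid at every `0/1` point (`2s − s² = 1 − (1 − s)² ≤ 1`). -/
theorem corRowMat_valid (a : Finset (Fin n)) (x : Fin n → ℝ) (hx : ∀ i, x i = 0 ∨ x i = 1) :
    ∑ i, ∑ j, corRowMat a i j * (x i * x j) ≤ 1 := by
  rw [corRowMat_form a x hx]
  nlinarith [sq_nonneg (1 - ∑ i, (if i ∈ a then (1 : ℝ) else 0) * x i)]

/-- The `0/1` indicator vector of `c ⊆ Fin n`. -/
def indVec (c : Finset (Fin n)) : Fin n → ℝ := fun i => if i ∈ c then 1 else 0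

/-- `indVec c` is a `0/1` vector. -/
theorem indVec_zero_or_one (c : Finset (Fin n)) (i : Fin n) : indVec c i = 0 ∨ indVec c i = 1 := by
  unfold indVec; split_ifs <;> simp

/-- The slack of the row `c_a` at the vertex `1_c 1_cᵀ` is `UDISJ(n)(a, c) = (1 − |a ∩ c|)²`. -/
theorem corRow_slack_eq_udisj (a c : Finset (Fin n)) :
    1 - ∑ i, ∑ j, corRowMat a i j * (indVec c i * indVec c j) = udisj n a c := by
  rw [corRowMat_form a (indVec c) (indVec_zero_or_one c)]
  have hs : ∑ i, (if i ∈ a then (1 : ℝ) else 0) * indVec c i = ((a ∩ c).card : ℝ) := by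
    have h1 : ∀ i, (if i ∈ a then (1 : ℝ) else 0) * indVec c i = if i ∈ a ∩ c then 1 else 0 := by
      intro i
      unfold indVec
      by_cases ha : i ∈ a <;> by_cases hc : i ∈ c <;> simp [ha, hc]
    simp_rw [h1]
    rw [sum_boole, filter_mem_eq_inter, univ_inter]
  rw [hs]
  unfold udisj
  ring

/-- **Block-diagonal psd lifts of the correlation polytope.** For `n ≥ 2`, `b ≥ 1`: if the full slack matrix
of `CORR_n = conv{x xᵀ : x ∈ {0,1}ⁿ}` — rows = all valid inequalities `Σ_{ij} c_{ij} x_i x_j ≤ β` on `{0,1}ⁿ`,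
columns = all `x ∈ {0,1}ⁿ`, as in `Literature.Combinatorics.Optimization.LeeRaghavendraSteurer2015_thm11` —
has a psd factorization through `m` blocks of size `b` (`slack = Σ_{k<m} tr(U^k V^k)`, `U^k, V^k ∈ S^b_+`;
by the cone factorization theorem this is an `(S^b_+)^m`-lift of `CORR_n` [cite: FawziParrilo2013, Thm. 2]),
then `(3/2)^{n/(b+1)} ≤ m · 14400 b⁵ n⁶`. In particular a block-diagonal SDP lift of the cut polytope with
`m ≤ n^k` blocks has a block of dimension `≥ n log(3/2)/((k+6) log n + 10) − 1`. -/
theorem corr_blockPsd {b m : ℕ} (hn : 2 ≤ n) (hb : 1 ≤ b)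
    (U : {cb : Matrix (Fin n) (Fin n) ℝ × ℝ //
            ∀ x : Fin n → ℝ, (∀ i, x i = 0 ∨ x i = 1) →
              ∑ i, ∑ j, cb.1 i j * (x i * x j) ≤ cb.2} → Fin m → Matrix (Fin b) (Fin b) ℝ)
    (V : {x : Fin n → ℝ // ∀ i, x i = 0 ∨ x i = 1} → Fin m → Matrix (Fin b) (Fin b) ℝ)
    (hU : ∀ cb k, (U cb k).PosSemidef) (hV : ∀ x k, (V x k).PosSemidef)
    (hfac : ∀ cb x, cb.1.2 - ∑ i, ∑ j, cb.1.1 i j * (x.1 i * x.1 j) = ∑ k, (U cb k * V x k).trace) :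
    (3 / 2 : ℝ) ^ ((n : ℝ) / (b + 1)) ≤ m * (14400 * (b : ℝ) ^ 5 * (n : ℝ) ^ 6) := by
  -- restrict the factorization to the rows `c_a` and the vertices `1_c`
  let row : Finset (Fin n) → {cb : Matrix (Fin n) (Fin n) ℝ × ℝ //
      ∀ x : Fin n → ℝ, (∀ i, x i = 0 ∨ x i = 1) → ∑ i, ∑ j, cb.1 i j * (x i * x j) ≤ cb.2} :=
    fun a => ⟨(corRowMat a, 1), fun x hx => corRowMat_valid a x hx⟩
  let vert : Finset (Fin n) → {x : Fin n → ℝ // ∀ i, x i = 0 ∨ x i = 1} :=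
    fun c => ⟨indVec c, indVec_zero_or_one c⟩
  refine udisj_blockPsd hn hb (fun a k => U (row a) k) (fun c k => V (vert c) k)
    (fun a k => hU _ k) (fun c k => hV _ k) fun a c => ?_
  rw [← hfac (row a) (vert c)]
  exact (corRow_slack_eq_udisj a c).symm

end Summit.PneNP.PneNP.Theorems.SupportRectangleBlockLift

end
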